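import Summits.HodgeConjecture.CorCM.D2Bridge.ClosedPrintedMuKeyIdentLemD3DelRecConjOmegaT
import HarnessLib

/-!
# COR-CM — the AT-PLACE glue `hc_cm_of_hyps_atPlace` (cell hodgecm-mathlib, director g1 03:02:54Z (a) / 03:10:39Z; A-p01)

`hc_cm_of_hyps_atPlace` = the headline ✔ `MuKeyIdentLemD3DelRecConjOmegaEndT.hc_cm_of_printed_citations_muKey_ident_lemD3_delRecConjOmegaT`
(`D2Bridge/ClosedPrintedMuKeyIdentLemD3DelRecConjOmegaT.lean`, the seven binders hDel ∕ h21 ∕ hLiu418 ∕ h411 ∕ h413 ∕ hD3 ∕ hD1'' VERBATIM) with the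
canonicity hypothesis `(hV : (NumberField.InfinitePlace.mk ι₁).embedding = ι₁)` inserted after `(V : HodgeCM.HermSpace3 F ι₁)` in the rows
**`h413` ([Liu 2021, Prop. 4.13]) and `hD3` ([Liu 2021, App. D Lem. D.1 (3)])** — the two Liu rows that the END consumes ONLY inside the localised
reading `h418` of ✔ `Model.hc_cm_of_port_meeting_rec_local` ∕ `hM_of_port_local`, i.e. under `hV` (✔ `MuConjEnd.thm418C_indexOfRecord_of_muConj`
at `(F) (h6) (V) (hV) (a₀)`, `ClosedPrintedMuConj.lean` :128 ∕ `ClosedPrintedMuKey.lean` §B).  The other three Liu rows (`hLiu418`, `h411`, `hD1''`)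
are displayed UNCHANGED: the END also consumes them OFF place, on the «Hom ≠ 0» side (✔ `MuKeyEnd.hHom_of_scalar_rows` at `ν := μ(Φ,ι₁)` for every
`ι₁ ∈ Φ`, feeding W2 ✔ `Model.hc_cm_of_homNeZero_along_conj_holds_restOne_epi_meeting_rec` and `faceSupply_of_homNeZero_pinned_isog_along`), so
weakening them is not a re-threading (reported on STATUS 03:13:36Z).

KERNEL (pure re-threading, debt 0): the headline's own step (T) `MuConjIdent.thm418AsPrinted_muConj_rest_of_transport_hermConj` +
`exists_recordSystemConj_X_sec42DataOf_levelOf_eq`, pointwise; ✔ N211's identification `MuConjIdent.toThm418Data_muConj_rest_eq_printed_ofRecord`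
(`rfl`-transport), pointwise; then W2 at `hHom := MuKeyEnd.hHom_of_scalar_rows h hLiuC h411 hD1''` and `hM := hM_of_port_local h418` with
`h418 := MuConjEnd.thm418C_indexOfRecord_of_muConj F h6 V hV a₀ …` whose `h413` ∕ `hμsep` inputs are read from the at-place rows
(`hμsep` from `hD3` + `hD1''` by ✔ `MuKeyIdentLemD3End.mu_eq_of_areIsomorphic_uniformOmegaRep_of_lemD1_3AsPrintedI`, as in N157).
HC_CM is NOT proved unconditionally: the seven displayed citations are hypotheses (HC_CM is proved only modulo the 7 printed citations
until rung 0 closes).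
-/

set_option autoImplicit false

namespace Summit.HodgeConjecture.CorCM.D2Bridge.AtPlaceEndT

open scoped TensorProduct Matrix
open NumberField NumberField.InfinitePlace
open HodgeCM.Model HodgeCM.Model.LiuIndex HodgeCM.Model.TowerCarrier
open HodgeCM.Literature.Theta.LiuAlbaneseModuleDatum.D2Bridge (HcmPieces)
open Summit.HodgeConjecture.CorCM.Model
open Literature.AlgebraicGeometry.Motives (CMType)
open Literature.AlgebraicGeometry.HodgeTheory Literature.NumberTheory.Automorphic.PicardCM
open Literature.AlgebraicGeometry.ShimuraVarieties.UnitaryCanonicalModel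
open Literature.NumberTheory.ComplexMultiplication
open Literature.NumberTheory.Automorphic
open Literature.NumberTheory.Automorphic.IdeleClassGroup (toHeckeCharacter isUnitary_toHeckeCharacter galConj)
open Literature.NumberTheory.Automorphic.Liu2021 Literature.NumberTheory.Automorphic.Liu2021.AppendixC
open Literature.NumberTheory.Automorphic.Liu2021.AppendixC.RestOne
open Literature.NumberTheory.Automorphic.Liu2021.Def411WeilCarriers (lineOf locF Rep)
open Summit.HodgeConjecture.CorCM.Transposition.OmegaTransport (realUnit)
open HodgeCM.Model.ArchSideTerm (e₁)
open Literature.NumberTheory.GelbartRogawski1991 Literature.NumberTheory.GelbartRogawski1991.UnitaryDualPair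
open Literature.NumberTheory.GelbartRogawski1991.UnitaryDualPair.LocalSplitting (localMu norm_localMu continuous_localMu localMu_toLocalRing_eq_one_iff
  eq_of_forall_localMu_toHeckeCharacter_eq)
open Literature.RepresentationTheory Literature.RepresentationTheory.Liu2021
open Summit.HodgeConjecture.CorCM.Transposition
open Summit.HodgeConjecture.CorCM.D2Bridge.AdapterMuConj (muConj prop413AsPrinted_muConj def411_muConj nontrivial_omegaAt_muConj_rest)
open Summit.HodgeConjecture.CorCM.D2Bridge.AdapterRelabel (isReflexOfTypeG_cmType_iff_starRingEnd_comp_galConj)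
open Summit.HodgeConjecture.CorCM.D2Bridge.MuConjEnd (thm418C_indexOfRecord_of_muConj)
open Summit.HodgeConjecture.CorCM.D2Bridge.MuKeyIdentLemD3End
open Summit.HodgeConjecture.CorCM.D2Bridge.MuKeyIdentLemD3DelRecConjOmegaEnd (diagonal_frameD_map_complexConj)

/-! ## The at-place glue: the headline with `hV` inserted in `h413` and `hD3` -/

set_option synthInstance.maxHeartbeats 400000 in
set_option maxHeartbeats 8000000 in
/-- **`hc_cm_of_hyps_atPlace` — the headline `hc_cm_of_printed_citations_muKey_ident_lemD3_delRecConjOmegaT` with the canonicity hypothesis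
`(hV : (NumberField.InfinitePlace.mk ι₁).embedding = ι₁)` inserted after `(V : HodgeCM.HermSpace3 F ι₁)` in the rows `h413` ([Liu 2021, Prop. 4.13]
AS PRINTED at the tower) and `hD3` ([Liu 2021, App. D Lem. D.1 (3)] AS PRINTED per place, indexed family)**; all other binders (hDel, h21, hLiu418,
h411, hD1'') are the headline's VERBATIM.  Sound by pure re-threading: `h413` and `hD3` reach the END only through the localised reading
`h418 := MuConjEnd.thm418C_indexOfRecord_of_muConj F h6 V hV a₀ …` inside `hM_of_port_local`, which carries `hV`; the headline's own transport
step (T) and the `rfl`-identification of ✔ `MuKeyIdentEnd` are repeated pointwise, then W2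
`Model.hc_cm_of_homNeZero_along_conj_holds_restOne_epi_meeting_rec` at `hHom := MuKeyEnd.hHom_of_scalar_rows h hLiuC h411 hD1''`.
HC_CM is NOT proved unconditionally: the displayed citations are hypotheses.
[cite: Liu2021, Thm 4.18 p. 52; Def 4.11–4.12 pp. 48–49; Prop 4.13 p. 50; App. D Lem D.1 pp. 86–87; App. C §C.1 and Rem. C.2]
[cite: Deligne1979ShimuraVarieties, §2.1.2–2.1.4, 2.2.4–2.2.5 and Cor. 2.7.21 (PDF pp. 24, 29, 52 of Milne's translation)]
[cite: Shimura1998, §21.4 Thm. 21.4] [cite: Milne2005ShimuraVarieties, Def. 12.8 (62) p. 114; Def. 12.10 p. 115] [cite: Kudla1996, V.3] -/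
theorem hc_cm_of_hyps_atPlace
    (hDel : Literature.AlgebraicGeometry.ShimuraVarieties.UnitaryCanonicalModel.canonicalModel_exists_printed)
    (h21 : shimura1998_thm21_4_casselman)
    -- [Liu21, Thm 4.18] AS PRINTED for the CONJUGATE space (𝕍^(c), ν): the TRANSPORTED datum = VERBATIM the h′ type of T = ✔ Ω-VII :311 `MuConjIdent.thm418AsPrinted_muConj_rest_of_transport_hermConj` at the END's objects (group U(V^(c))(𝔸_{F⁺,f}) natively through (adelicFinConj V)⁻¹, Liu's own collections map `epsOf δ′`, the conjugate space's own [Def 4.11] family 𝕌_{V^(c)} at the label ν; tail t = the rest of record at ν, so the source datum is D_print(a, ν) by rfl), UNDER the space-identification binder (R', hR') = the conclusion of R6 VERBATIM; Φ′ universally quantified; NO hΩ binder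
    (hLiu418 : ∀ (F : HodgeCM.CMField) [IsGalois ℚ F] (h6 : 6 ≤ Module.finrank ℚ F) {ι₁ : F →+* ℂ} (V : HodgeCM.HermSpace3 F ι₁) (a : RealScalar F)
      (Φ : CMType F) (hΦ : ι₁ ∈ Φ.1) (ν : Literature.NumberTheory.Automorphic.IdeleClassGroup (F : Type) →ₜ* Circle)
      (hν : IdeleClassGroup.IsConjugateSymplectic (F : Type) ν) (hw : IdeleClassGroup.HasWeight (F : Type) ν 1)
      (R' : RecordSystem (HodgeCM.CMField.K F) (Summit.HodgeConjecture.CorCM.Model.RecordSystemConj.conjGram (HodgeCM.CMField.K F) (HodgeCM.HermSpace3.Hm V)) ι₁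
        (Summit.HodgeConjecture.CorCM.Model.RecordSystemConj.conjFrame (Summit.HodgeConjecture.CorCM.Model.frameOf (⟨HodgeCM.HermSpace3.Hm V, HodgeCM.HermSpace3.isHermitian V, HodgeCM.HermSpace3.signature_ι₁ V, HodgeCM.HermSpace3.posDef_of_ne V⟩ : Summit.HodgeConjecture.CorCM.HermSpace3 ⟨HodgeCM.CMField.K F⟩ ι₁)))
        (Summit.HodgeConjecture.CorCM.Model.RecordSystemConj.formCongr_conjFrame (HodgeCM.CMField.K F) (HodgeCM.HermSpace3.Hm V) ι₁ (Summit.HodgeConjecture.CorCM.Model.frameOf (⟨HodgeCM.HermSpace3.Hm V, HodgeCM.HermSpace3.isHermitian V, HodgeCM.HermSpace3.signature_ι₁ V, HodgeCM.HermSpace3.posDef_of_ne V⟩ : Summit.HodgeConjecture.CorCM.HermSpace3 ⟨HodgeCM.CMField.K F⟩ ι₁))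
          (Summit.HodgeConjecture.CorCM.Model.formCongr_frameOf (⟨HodgeCM.HermSpace3.Hm V, HodgeCM.HermSpace3.isHermitian V, HodgeCM.HermSpace3.signature_ι₁ V, HodgeCM.HermSpace3.posDef_of_ne V⟩ : Summit.HodgeConjecture.CorCM.HermSpace3 ⟨HodgeCM.CMField.K F⟩ ι₁)))
        (Summit.HodgeConjecture.CorCM.Model.RecordSystemConj.conjLevel₀ (HodgeCM.CMField.K F) (HodgeCM.HermSpace3.Hm V) (Summit.HodgeConjecture.CorCM.HComp.K3 (⟨HodgeCM.HermSpace3.Hm V, HodgeCM.HermSpace3.isHermitian V, HodgeCM.HermSpace3.signature_ι₁ V, HodgeCM.HermSpace3.posDef_of_ne V⟩ : Summit.HodgeConjecture.CorCM.HermSpace3 ⟨HodgeCM.CMField.K F⟩ ι₁))))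
      (hR' : CategoryTheory.Functor.comp (Summit.HodgeConjecture.CorCM.Model.RecordSystemConj.smallLevelConjBack (HodgeCM.CMField.K F) (HodgeCM.HermSpace3.Hm V) (Summit.HodgeConjecture.CorCM.HComp.K3 (⟨HodgeCM.HermSpace3.Hm V, HodgeCM.HermSpace3.isHermitian V, HodgeCM.HermSpace3.signature_ι₁ V, HodgeCM.HermSpace3.posDef_of_ne V⟩ : Summit.HodgeConjecture.CorCM.HermSpace3 ⟨HodgeCM.CMField.K F⟩ ι₁))) (Summit.HodgeConjecture.CorCM.Model.sec42DataOfFourLe (Summit.HodgeConjecture.CorCM.DelRec.exists_recordSystem_of_printed hDel) (⟨HodgeCM.HermSpace3.Hm V, HodgeCM.HermSpace3.isHermitian V, HodgeCM.HermSpace3.signature_ι₁ V, HodgeCM.HermSpace3.posDef_of_ne V⟩ : Summit.HodgeConjecture.CorCM.HermSpace3 ⟨HodgeCM.CMField.K F⟩ ι₁) Φ (le_trans (Nat.le_of_ble_eq_true rfl) h6) (isoOf ⟨HodgeCM.CMField.K F⟩ ι₁ (⟨HodgeCM.HermSpace3.Hm V, HodgeCM.HermSpace3.isHermitian V, HodgeCM.HermSpace3.signature_ι₁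 V, HodgeCM.HermSpace3.posDef_of_ne V⟩ : Summit.HodgeConjecture.CorCM.HermSpace3 ⟨HodgeCM.CMField.K F⟩ ι₁) Φ)).cpt.X = R'.M ∧
        ∀ K : Subgroup (Summit.HodgeConjecture.CorCM.Model.honestP5Of (Summit.HodgeConjecture.CorCM.DelRec.exists_recordSystem_of_printed hDel) ⟨HodgeCM.CMField.K F⟩ ι₁ ⟨HodgeCM.HermSpace3.Hm V, HodgeCM.HermSpace3.isHermitian V, HodgeCM.HermSpace3.signature_ι₁ V, HodgeCM.HermSpace3.posDef_of_ne V⟩ Φ).G,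
          (sec42DataOf (Summit.HodgeConjecture.CorCM.DelRec.exists_recordSystem_of_printed hDel) isoOf ⟨HodgeCM.CMField.K F⟩ ι₁ ⟨HodgeCM.HermSpace3.Hm V, HodgeCM.HermSpace3.isHermitian V, HodgeCM.HermSpace3.signature_ι₁ V, HodgeCM.HermSpace3.posDef_of_ne V⟩ Φ).X ((sec42DataOf (Summit.HodgeConjecture.CorCM.DelRec.exists_recordSystem_of_printed hDel) isoOf ⟨HodgeCM.CMField.K F⟩ ι₁ ⟨HodgeCM.HermSpace3.Hm V, HodgeCM.HermSpace3.isHermitian V, HodgeCM.HermSpace3.signature_ι₁ V, HodgeCM.HermSpace3.posDef_of_ne V⟩ Φ).levelOf K) =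
            R'.M.obj (⟨C5.OpenCompactSubgroup.transport (Summit.HodgeConjecture.CorCM.Model.RecordSystemConj.groupConj (HodgeCM.CMField.K F) (HodgeCM.HermSpace3.Hm V)) ((Summit.HodgeConjecture.CorCM.Model.sec42DataOfFourLe (Summit.HodgeConjecture.CorCM.DelRec.exists_recordSystem_of_printed hDel) (⟨HodgeCM.HermSpace3.Hm V, HodgeCM.HermSpace3.isHermitian V, HodgeCM.HermSpace3.signature_ι₁ V, HodgeCM.HermSpace3.posDef_of_ne V⟩ : Summit.HodgeConjecture.CorCM.HermSpace3 ⟨HodgeCM.CMField.K F⟩ ι₁) Φ (le_trans (Nat.le_of_ble_eq_true rfl) h6) (isoOf ⟨HodgeCM.CMField.K F⟩ ι₁ (⟨HodgeCM.HermSpace3.Hm V, HodgeCM.HermSpace3.isHermitian V, HodgeCM.HermSpace3.signature_ι₁ V, HodgeCM.HermSpace3.posDef_of_ne V⟩ : Summit.HodgeConjecture.CorCM.HermSpace3 ⟨HodgeCM.CMField.K F⟩ ι₁) Φ)).levelOf K).1,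
              C5.OpenCompactSubgroup.transport_mono (Summit.HodgeConjecture.CorCM.Model.RecordSystemConj.groupConj (HodgeCM.CMField.K F) (HodgeCM.HermSpace3.Hm V)) ((Summit.HodgeConjecture.CorCM.Model.sec42DataOfFourLe (Summit.HodgeConjecture.CorCM.DelRec.exists_recordSystem_of_printed hDel) (⟨HodgeCM.HermSpace3.Hm V, HodgeCM.HermSpace3.isHermitian V, HodgeCM.HermSpace3.signature_ι₁ V, HodgeCM.HermSpace3.posDef_of_ne V⟩ : Summit.HodgeConjecture.CorCM.HermSpace3 ⟨HodgeCM.CMField.K F⟩ ι₁) Φ (le_trans (Nat.le_of_ble_eq_true rfl) h6) (isoOf ⟨HodgeCM.CMField.K F⟩ ι₁ (⟨HodgeCM.HermSpace3.Hm V, HodgeCM.HermSpace3.isHermitian V, HodgeCM.HermSpace3.signature_ι₁ V, HodgeCM.HermSpace3.posDef_of_ne V⟩ : Summit.HodgeConjecture.CorCM.HermSpace3 ⟨HodgeCM.CMField.K F⟩ ι₁) Φ)).levelOf K).2⟩ :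
              C5.SmallLevel (Summit.HodgeConjecture.CorCM.Model.RecordSystemConj.conjLevel₀ (HodgeCM.CMField.K F) (HodgeCM.HermSpace3.Hm V) (Summit.HodgeConjecture.CorCM.HComp.K3 (⟨HodgeCM.HermSpace3.Hm V, HodgeCM.HermSpace3.isHermitian V, HodgeCM.HermSpace3.signature_ι₁ V, HodgeCM.HermSpace3.posDef_of_ne V⟩ : Summit.HodgeConjecture.CorCM.HermSpace3 ⟨HodgeCM.CMField.K F⟩ ι₁)))))
      (Φ' : CMType F),
      Thm418AsPrinted ((toThm418Data (sec42DataOf (Summit.HodgeConjecture.CorCM.DelRec.exists_recordSystem_of_printed hDel) isoOf ⟨HodgeCM.CMField.K F⟩ ι₁ ⟨HodgeCM.HermSpace3.Hm V, HodgeCM.HermSpace3.isHermitian V, HodgeCM.HermSpace3.signature_ι₁ V, HodgeCM.HermSpace3.posDef_of_ne V⟩ Φ) ((Summit.HodgeConjecture.CorCM.D2Bridge.AdapterMuConj.muConj (uniformOmegaRep (Summit.HodgeConjecture.CorCM.DelRec.exists_recordSystem_of_printed hDel) ⟨HodgeCM.CMField.K F⟩ ι₁ ⟨HodgeCM.HermSpace3.Hm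 V, HodgeCM.HermSpace3.isHermitian V, HodgeCM.HermSpace3.signature_ι₁ V, HodgeCM.HermSpace3.posDef_of_ne V⟩ Φ e₁ (frameD V) (frameD_real V) (frameD_ne V) (ιVE V) (2 * imagUnit (HodgeCM.CMField.K F))⁻¹ (fun _ _ => (Rep.update ↥(maximalRealSubfield (HodgeCM.CMField.K F)) (imagUnitSq (HodgeCM.CMField.K F)) (Rep.ofLineOf ↥(maximalRealSubfield (HodgeCM.CMField.K F)) (imagUnitSq (HodgeCM.CMField.K F))) (locF ↥(maximalRealSubfield (HodgeCM.CMField.K F)) (imagUnitSq (HodgeCM.CMField.K F)) (realUnit ⟨HodgeCM.CMField.K F⟩ a.1 a.2.1 a.2.2)) (realUnit ⟨HodgeCM.CMField.K F⟩ a.1 a.2.1 a.2.2) rfl)))).rest (restTailOne (AlgHom.id ℚ _) ι₁ hν hw (Def45.Carriers.ofPolDR ν (Def45.PolDR ι₁ hν (Def45.RMuForm ι₁ hν))) ((heckeTranslatesFamilyOf heckeTranslate_definedOver_holds (Summit.HodgeConjecture.CorCM.DelRec.exists_recordSystem_of_printed hDel) isoOf ⟨HodgeCM.CMField.K F⟩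 ι₁ ⟨HodgeCM.HermSpace3.Hm V, HodgeCM.HermSpace3.isHermitian V, HodgeCM.HermSpace3.signature_ι₁ V, HodgeCM.HermSpace3.posDef_of_ne V⟩ Φ h6).rhoΩOne (AlgHom.id ℚ _) ι₁ hν hw (Def45.Carriers.ofPolDR ν (Def45.PolDR ι₁ hν (Def45.RMuForm ι₁ hν))))))).transport
        (sec42DataOf (Summit.HodgeConjecture.CorCM.DelRec.exists_recordSystem_of_printed hDel) isoOf ⟨HodgeCM.CMField.K F⟩ ι₁ (⟨HodgeCM.HermSpace3.Hm V, HodgeCM.HermSpace3.isHermitian V, HodgeCM.HermSpace3.signature_ι₁ V, HodgeCM.HermSpace3.posDef_of_ne V⟩ : Summit.HodgeConjecture.CorCM.HermSpace3 ⟨HodgeCM.CMField.K F⟩ ι₁).conj Φ').G (Summit.HodgeConjecture.CorCM.HermSpace3.adelicFinConj (⟨HodgeCM.HermSpace3.Hm V, HodgeCM.HermSpace3.isHermitian V, HodgeCM.HermSpace3.signature_ι₁ V, HodgeCM.HermSpace3.posDef_of_ne V⟩ : Summit.HodgeConjecture.CorCM.HermSpace3 ⟨HodgeCM.CMField.K F⟩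 ι₁)).symm
        (Literature.NumberTheory.Automorphic.Liu2021.Def411WeilCarriers.Eps ↥(maximalRealSubfield (HodgeCM.CMField.K F)) (imagUnitSq (HodgeCM.CMField.K F))) (Literature.NumberTheory.Automorphic.Liu2021.Def411WeilCarriers.epsOf ↥(maximalRealSubfield (HodgeCM.CMField.K F)) (imagUnitSq (HodgeCM.CMField.K F)) (HodgeCM.CMField.K F) (2 * imagUnit (HodgeCM.CMField.K F))⁻¹)
        (Literature.NumberTheory.Automorphic.Liu2021.Def411WeilCarriers.Chi ↥(maximalRealSubfield (HodgeCM.CMField.K F)) (HodgeCM.CMField.K F) (IsCMField.complexConj (HodgeCM.CMField.K F)))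
        ((uniformOmegaRep (Summit.HodgeConjecture.CorCM.DelRec.exists_recordSystem_of_printed hDel) ⟨HodgeCM.CMField.K F⟩ ι₁ (⟨HodgeCM.HermSpace3.Hm V, HodgeCM.HermSpace3.isHermitian V, HodgeCM.HermSpace3.signature_ι₁ V, HodgeCM.HermSpace3.posDef_of_ne V⟩ : Summit.HodgeConjecture.CorCM.HermSpace3 ⟨HodgeCM.CMField.K F⟩ ι₁).conj Φ' e₁ (frameD V) (frameD_real V) (frameD_ne V) (Summit.HodgeConjecture.CorCM.HComp.OmegaConj.iotaVConj (Summit.HodgeConjecture.CorCM.DelRec.exists_recordSystem_of_printed hDel) ⟨HodgeCM.CMField.K F⟩ ι₁ (⟨HodgeCM.HermSpace3.Hm V, HodgeCM.HermSpace3.isHermitian V, HodgeCM.HermSpace3.signature_ι₁ V, HodgeCM.HermSpace3.posDef_of_ne V⟩ : Summit.HodgeConjecture.CorCM.HermSpace3 ⟨HodgeCM.CMField.K F⟩ ι₁) Φ Φ' (frameD V) (ιVE V) (diagonal_frameD_map_complexConj F V)) (2 * imagUnit (HodgeCM.CMField.K F))⁻¹ (Summit.HodgeConjecture.CorCM.D2Bridge.MuConjIdent.repConj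 ⟨HodgeCM.CMField.K F⟩ (fun _ _ => (Rep.update ↥(maximalRealSubfield (HodgeCM.CMField.K F)) (imagUnitSq (HodgeCM.CMField.K F)) (Rep.ofLineOf ↥(maximalRealSubfield (HodgeCM.CMField.K F)) (imagUnitSq (HodgeCM.CMField.K F))) (locF ↥(maximalRealSubfield (HodgeCM.CMField.K F)) (imagUnitSq (HodgeCM.CMField.K F)) (realUnit ⟨HodgeCM.CMField.K F⟩ a.1 a.2.1 a.2.2)) (realUnit ⟨HodgeCM.CMField.K F⟩ a.1 a.2.1 a.2.2) rfl)))).omega ν hν)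
        ((uniformOmegaRep (Summit.HodgeConjecture.CorCM.DelRec.exists_recordSystem_of_printed hDel) ⟨HodgeCM.CMField.K F⟩ ι₁ (⟨HodgeCM.HermSpace3.Hm V, HodgeCM.HermSpace3.isHermitian V, HodgeCM.HermSpace3.signature_ι₁ V, HodgeCM.HermSpace3.posDef_of_ne V⟩ : Summit.HodgeConjecture.CorCM.HermSpace3 ⟨HodgeCM.CMField.K F⟩ ι₁).conj Φ' e₁ (frameD V) (frameD_real V) (frameD_ne V) (Summit.HodgeConjecture.CorCM.HComp.OmegaConj.iotaVConj (Summit.HodgeConjecture.CorCM.DelRec.exists_recordSystem_of_printed hDel) ⟨HodgeCM.CMField.K F⟩ ι₁ (⟨HodgeCM.HermSpace3.Hm V, HodgeCM.HermSpace3.isHermitian V, HodgeCM.HermSpace3.signature_ι₁ V, HodgeCM.HermSpace3.posDef_of_ne V⟩ : Summit.HodgeConjecture.CorCM.HermSpace3 ⟨HodgeCM.CMField.K F⟩ ι₁) Φ Φ' (frameD V) (ιVE V) (diagonal_frameD_map_complexConj F V)) (2 * imagUnit (HodgeCM.CMField.K F))⁻¹ (Summit.HodgeConjecture.CorCM.D2Bridge.MuConjIdent.repConj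 ⟨HodgeCM.CMField.K F⟩ (fun _ _ => (Rep.update ↥(maximalRealSubfield (HodgeCM.CMField.K F)) (imagUnitSq (HodgeCM.CMField.K F)) (Rep.ofLineOf ↥(maximalRealSubfield (HodgeCM.CMField.K F)) (imagUnitSq (HodgeCM.CMField.K F))) (locF ↥(maximalRealSubfield (HodgeCM.CMField.K F)) (imagUnitSq (HodgeCM.CMField.K F)) (realUnit ⟨HodgeCM.CMField.K F⟩ a.1 a.2.1 a.2.2)) (realUnit ⟨HodgeCM.CMField.K F⟩ a.1 a.2.1 a.2.2) rfl)))).rho ν hν)))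
    -- [Liu21, Def 4.11] ∕ [Prop 4.13] — VERBATIM ✔ p375902 (= ✔ p375090)
    (h411 : ∀ (F : HodgeCM.CMField) [IsGalois ℚ F] (h6 : 6 ≤ Module.finrank ℚ F) {ι₁ : F →+* ℂ} (V : HodgeCM.HermSpace3 F ι₁) (a : RealScalar F)
      (Φ : CMType F) (hΦ : ι₁ ∈ Φ.1) (μ : Literature.NumberTheory.Automorphic.IdeleClassGroup (F : Type) →ₜ* Circle)
      (hμ : IdeleClassGroup.IsConjugateSymplectic (F : Type) μ) (hw : IdeleClassGroup.HasWeight (F : Type) μ 1),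
      Def411AsPrinted (toThm418Data _ (restOfCharDeltaPrime (Summit.HodgeConjecture.CorCM.DelRec.exists_recordSystem_of_printed hDel) ⟨HodgeCM.CMField.K F⟩ h6 ι₁ ⟨HodgeCM.HermSpace3.Hm V, HodgeCM.HermSpace3.isHermitian V, HodgeCM.HermSpace3.signature_ι₁ V, HodgeCM.HermSpace3.posDef_of_ne V⟩ Φ e₁ (frameD V) (frameD_real V) (frameD_ne V) (ιVE V) (Rep.update ↥(maximalRealSubfield (HodgeCM.CMField.K F)) (imagUnitSq (HodgeCM.CMField.K F)) (Rep.ofLineOf ↥(maximalRealSubfield (HodgeCM.CMField.K F)) (imagUnitSq (HodgeCM.CMField.K F))) (locF ↥(maximalRealSubfield (HodgeCM.CMField.K F)) (imagUnitSq (HodgeCM.CMField.K F)) (realUnit ⟨HodgeCM.CMField.K F⟩ a.1 a.2.1 a.2.2)) (realUnit ⟨HodgeCM.CMField.K F⟩ a.1 a.2.1 a.2.2) rfl) μ hμ hw)))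
    (h413 : ∀ (F : HodgeCM.CMField) [IsGalois ℚ F] (h6 : 6 ≤ Module.finrank ℚ F) {ι₁ : F →+* ℂ} (V : HodgeCM.HermSpace3 F ι₁) (hV : (NumberField.InfinitePlace.mk ι₁).embedding = ι₁) (a₀ : RealScalar F)
      (Φ : CMType F) (hΦ : ι₁ ∈ Φ.1) (i : (I V (repAt a₀) (muLiu ι₁ GramClass.rep))), Prop413AsPrinted (((uniformOmegaRep (Summit.HodgeConjecture.CorCM.DelRec.exists_recordSystem_of_printed hDel) ⟨HodgeCM.CMField.K F⟩ ι₁ ⟨HodgeCM.HermSpace3.Hm V, HodgeCM.HermSpace3.isHermitian V, HodgeCM.HermSpace3.signature_ι₁ V, HodgeCM.HermSpace3.posDef_of_ne V⟩ Φ e₁ (frameD V) (frameD_real V) (frameD_ne V) (ιVE V) (2 * imagUnit (HodgeCM.CMField.K F))⁻¹ (fun _ _ => (Rep.update ↥(maximalRealSubfield (HodgeCM.CMField.K F)) (imagUnitSq (HodgeCM.CMField.K F)) (Rep.ofLineOf ↥(maximalRealSubfield (HodgeCM.CMField.K F)) (imagUnitSq (HodgeCM.CMField.K F))) (locF ↥(maximalRealSubfield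 (HodgeCM.CMField.K F)) (imagUnitSq (HodgeCM.CMField.K F)) (realUnit ⟨HodgeCM.CMField.K F⟩ (repAt a₀ (Sigma.fst i)).1 (repAt a₀ (Sigma.fst i)).2.1 (repAt a₀ (Sigma.fst i)).2.2)) (realUnit ⟨HodgeCM.CMField.K F⟩ (repAt a₀ (Sigma.fst i)).1 (repAt a₀ (Sigma.fst i)).2.1 (repAt a₀ (Sigma.fst i)).2.2) rfl)))).prop413Data ((liuDictionaryPin exists_isReal_hodgeModel_holds hodgePQ_independent_of_hodgeModel_holds BallQuotient.ballQuotientUniformised_holds (cmAbelianVarietyRealised_of_eigenbasis exists_isReal_hodgeModel_holds hodgePQ_independent_of_hodgeModel_holds cmAbelianVarietyEigenbasisRealised_holds) Literature.NumberTheory.Transcendental.arapura2012_cor_15_4_6_holds V (I V (repAt a₀) (muLiu ι₁ GramClass.rep)) (line V (repAt a₀) (muLiu ι₁ GramClass.rep)))).H))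
    -- [Liu21, App. D Lem D.1 (3)] AS PRINTED per place, read on the INDEXED FAMILY of the tree's own local data at U(J_V)(F⁺_v) of the admissible weight-one triples of 𝕌(a) — scalar-keyed
    (hD3 : ∀ (F : HodgeCM.CMField) [IsGalois ℚ F] (h6 : 6 ≤ Module.finrank ℚ F) {ι₁ : F →+* ℂ} (V : HodgeCM.HermSpace3 F ι₁) (hV : (NumberField.InfinitePlace.mk ι₁).embedding = ι₁) (a : RealScalar F)
      (Φ : CMType F) (hΦ : ι₁ ∈ Φ.1) (v : IsDedekindDomain.HeightOneSpectrum (𝓞 ↥(maximalRealSubfield (F : Type)))),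
      LemD1_3AsPrintedI (Def411WeilCarriers.localIndexedFamilyAtV (ι := ((μw : {μ : Literature.NumberTheory.Automorphic.IdeleClassGroup (F : Type) →ₜ* Circle // IdeleClassGroup.IsConjugateSymplectic (F : Type) μ ∧ IdeleClassGroup.HasWeight (F : Type) μ 1}) × (toThm418Data _ (restOfCharDeltaPrime (Summit.HodgeConjecture.CorCM.DelRec.exists_recordSystem_of_printed hDel) ⟨HodgeCM.CMField.K F⟩ h6 ι₁ ⟨HodgeCM.HermSpace3.Hm V, HodgeCM.HermSpace3.isHermitian V, HodgeCM.HermSpace3.signature_ι₁ V, HodgeCM.HermSpace3.posDef_of_ne V⟩ Φ e₁ (frameD V) (frameD_real V) (frameD_ne V) (ιVE V) (Rep.update ↥(maximalRealSubfield (HodgeCM.CMField.K F)) (imagUnitSq (HodgeCM.CMField.K F)) (Rep.ofLineOf ↥(maximalRealSubfield (HodgeCM.CMField.K F)) (imagUnitSq (HodgeCM.CMField.K F))) (locF ↥(maximalRealSubfield (HodgeCM.CMField.K F)) (imagUnitSq (HodgeCM.CMField.K F)) (realUnit ⟨HodgeCM.CMField.K F⟩ a.1 a.2.1 a.2.2))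 (realUnit ⟨HodgeCM.CMField.K F⟩ a.1 a.2.1 a.2.2) rfl) μw.1 μw.2.1 μw.2.2)).AdmIndex)) ↥(maximalRealSubfield (F : Type)) (F : Type) (IsCMField.complexConj (F : Type)) 3 e₁ (Matrix.diagonal (frameD V)) (complexConj_imagUnit (F : Type)) (imagUnit_ne_zero (F : Type)) (imagUnit_mul_self (F : Type)) (realDiagonal_isSymm (F : Type) (frameD V) (frameD_real V)) (isUnit_det_realDiagonal (F : Type) (frameD V) (frameD_real V) (frameD_ne V)) (realDiagonal_map (F : Type) (frameD V) (frameD_real V)).symm (le_refl 3) (fun t => (Rep.update ↥(maximalRealSubfield (HodgeCM.CMField.K F)) (imagUnitSq (HodgeCM.CMField.K F)) (Rep.ofLineOf ↥(maximalRealSubfield (HodgeCM.CMField.K F)) (imagUnitSq (HodgeCM.CMField.K F))) (locF ↥(maximalRealSubfield (HodgeCM.CMField.K F)) (imagUnitSq (HodgeCM.CMField.K F)) (realUnit ⟨HodgeCM.CMField.K F⟩ a.1 a.2.1 a.2.2)) (realUnit ⟨HodgeCM.CMField.K F⟩ a.1 a.2.1 a.2.2) rfl).toFun t.2.1.1) (fun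 t => t.2.1.2) (fun t => OmegaChiSplitting.chiLocalSplittingsD ⟨HodgeCM.CMField.K F⟩ e₁ (frameD V) (frameD_real V) (frameD_ne V) (toHeckeCharacter (F : Type) t.1.1) ((isOscillatorChar_toHeckeCharacter_iff t.1.1).mpr t.1.2.1) ((Rep.update ↥(maximalRealSubfield (HodgeCM.CMField.K F)) (imagUnitSq (HodgeCM.CMField.K F)) (Rep.ofLineOf ↥(maximalRealSubfield (HodgeCM.CMField.K F)) (imagUnitSq (HodgeCM.CMField.K F))) (locF ↥(maximalRealSubfield (HodgeCM.CMField.K F)) (imagUnitSq (HodgeCM.CMField.K F)) (realUnit ⟨HodgeCM.CMField.K F⟩ a.1 a.2.1 a.2.2)) (realUnit ⟨HodgeCM.CMField.K F⟩ a.1 a.2.1 a.2.2) rfl).toFun t.2.1.1)) (fun t => localMu (F : Type) (toHeckeCharacter (F : Type) t.1.1)) (fun t v x => norm_localMu (F : Type) (toHeckeCharacter (F : Type) t.1.1) v (isUnitary_toHeckeCharacter (F : Type) t.1.1) x) (fun t => continuous_localMu (F : Type) (toHeckeCharacter (F : Type) t.1.1)) (fun t v x => localMu_toLocalRing_eq_one_iff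 (F : Type) (toHeckeCharacter (F : Type) t.1.1) v ((isOscillatorChar_toHeckeCharacter_iff t.1.1).mpr t.1.2.1) x) v))
    -- [Liu21, App. D Lem D.1 (1)] AS PRINTED per place at the local data of 𝔯δ′⟦a, μ⟧ — VERBATIM ✔ p375902, UNGUARDED
    (hD1'' : ∀ (F : HodgeCM.CMField) [IsGalois ℚ F] (h6 : 6 ≤ Module.finrank ℚ F) {ι₁ : F →+* ℂ} (V : HodgeCM.HermSpace3 F ι₁) (a : RealScalar F)
      (Φ : CMType F) (hΦ : ι₁ ∈ Φ.1) (μ : Literature.NumberTheory.Automorphic.IdeleClassGroup (F : Type) →ₜ* Circle)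
      (hμ : IdeleClassGroup.IsConjugateSymplectic (F : Type) μ) (hw : IdeleClassGroup.HasWeight (F : Type) μ 1)
      (j : (toThm418Data _ (restOfCharDeltaPrime (Summit.HodgeConjecture.CorCM.DelRec.exists_recordSystem_of_printed hDel) ⟨HodgeCM.CMField.K F⟩ h6 ι₁ ⟨HodgeCM.HermSpace3.Hm V, HodgeCM.HermSpace3.isHermitian V, HodgeCM.HermSpace3.signature_ι₁ V, HodgeCM.HermSpace3.posDef_of_ne V⟩ Φ e₁ (frameD V) (frameD_real V) (frameD_ne V) (ιVE V) (Rep.update ↥(maximalRealSubfield (HodgeCM.CMField.K F)) (imagUnitSq (HodgeCM.CMField.K F)) (Rep.ofLineOf ↥(maximalRealSubfield (HodgeCM.CMField.K F)) (imagUnitSq (HodgeCM.CMField.K F))) (locF ↥(maximalRealSubfield (HodgeCM.CMField.K F)) (imagUnitSq (HodgeCM.CMField.K F)) (realUnit ⟨HodgeCM.CMField.K F⟩ a.1 a.2.1 a.2.2)) (realUnit ⟨HodgeCM.CMField.K F⟩ a.1 a.2.1 a.2.2) rfl) μ hμ hw)).AdmIndex) (v : IsDedekindDomain.HeightOneSpectrum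 (𝓞 ↥(maximalRealSubfield (F : Type)))),
      LemD1_1AsPrinted
        (Def411WeilCarriers.localLemD1Data ↥(maximalRealSubfield (F : Type)) (F : Type) (IsCMField.complexConj (F : Type)) 3 e₁
          (Matrix.diagonal (frameD V)) (complexConj_imagUnit (F : Type)) (imagUnit_ne_zero (F : Type)) (imagUnit_mul_self (F : Type))
          (realDiagonal_isSymm (F : Type) (frameD V) (frameD_real V)) (isUnit_det_realDiagonal (F : Type) (frameD V) (frameD_real V) (frameD_ne V))
          (realDiagonal_map (F : Type) (frameD V) (frameD_real V)).symm (((Rep.update ↥(maximalRealSubfield (HodgeCM.CMField.K F)) (imagUnitSq (HodgeCM.CMField.K F)) (Rep.ofLineOf ↥(maximalRealSubfield (HodgeCM.CMField.K F)) (imagUnitSq (HodgeCM.CMField.K F))) (locF ↥(maximalRealSubfield (HodgeCM.CMField.K F)) (imagUnitSq (HodgeCM.CMField.K F)) (realUnit ⟨HodgeCM.CMField.K F⟩ a.1 a.2.1 a.2.2)) (realUnit ⟨HodgeCM.CMField.K F⟩ a.1 a.2.1 a.2.2) rfl)).toFun j.1.1)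
          (OmegaChiSplitting.chiLocalSplittingsD ⟨HodgeCM.CMField.K F⟩ e₁ (frameD V) (frameD_real V) (frameD_ne V) (toHeckeCharacter (F : Type) μ)
            ((isOscillatorChar_toHeckeCharacter_iff μ).mpr hμ) (((Rep.update ↥(maximalRealSubfield (HodgeCM.CMField.K F)) (imagUnitSq (HodgeCM.CMField.K F)) (Rep.ofLineOf ↥(maximalRealSubfield (HodgeCM.CMField.K F)) (imagUnitSq (HodgeCM.CMField.K F))) (locF ↥(maximalRealSubfield (HodgeCM.CMField.K F)) (imagUnitSq (HodgeCM.CMField.K F)) (realUnit ⟨HodgeCM.CMField.K F⟩ a.1 a.2.1 a.2.2)) (realUnit ⟨HodgeCM.CMField.K F⟩ a.1 a.2.1 a.2.2) rfl)).toFun j.1.1))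
          (le_refl 3) (localMu (F : Type) (toHeckeCharacter (F : Type) μ))
          (fun v x => norm_localMu (F : Type) (toHeckeCharacter (F : Type) μ) v (isUnitary_toHeckeCharacter (F : Type) μ) x)
          (continuous_localMu (F : Type) (toHeckeCharacter (F : Type) μ))
          (fun v t => localMu_toLocalRing_eq_one_iff (F : Type) (toHeckeCharacter (F : Type) μ) v ((isOscillatorChar_toHeckeCharacter_iff μ).mpr hμ) t)
          j.1.2.1
          (Def411WeilCarriers.norm_chi_eq_one ↥(maximalRealSubfield (F : Type)) (F : Type) (IsCMField.complexConj (F : Type))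
            (Algebra.IsQuadraticExtension.finrank_eq_two ↥(maximalRealSubfield (F : Type)) (F : Type))
            (UnitaryGroup.algEquiv_ne_one_of_apply_eq_neg ↥(maximalRealSubfield (F : Type)) (F : Type) (IsCMField.complexConj (F : Type))
              (complexConj_imagUnit (F : Type)) (imagUnit_ne_zero (F : Type))) j.1.2)
          j.1.2.2.1 v))
    : HC_CM := by
  have h : exists_recordSystem := (Summit.HodgeConjecture.CorCM.DelRec.exists_recordSystem_of_printed hDel)
  -- (T) [Thm. 4.18] at the conjugate space's transported datum ⟹ at the printed datum `D_print(a, ν)` (the headline's own step), pointwise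
  have hLiu418' : ∀ (F : HodgeCM.CMField) [IsGalois ℚ F] (h6 : 6 ≤ Module.finrank ℚ F) {ι₁ : F →+* ℂ} (V : HodgeCM.HermSpace3 F ι₁) (a : RealScalar F)
        (Φ : CMType F) (hΦ : ι₁ ∈ Φ.1) (ν : Literature.NumberTheory.Automorphic.IdeleClassGroup (F : Type) →ₜ* Circle)
        (hν : IdeleClassGroup.IsConjugateSymplectic (F : Type) ν) (hw : IdeleClassGroup.HasWeight (F : Type) ν 1),
        Thm418AsPrinted (toThm418Data (sec42DataOf h isoOf ⟨HodgeCM.CMField.K F⟩ ι₁ ⟨HodgeCM.HermSpace3.Hm V, HodgeCM.HermSpace3.isHermitian V, HodgeCM.HermSpace3.signature_ι₁ V, HodgeCM.HermSpace3.posDef_of_ne V⟩ Φ)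
          ((heckeTranslatesFamilyOf heckeTranslate_definedOver_holds h isoOf ⟨HodgeCM.CMField.K F⟩ ι₁ ⟨HodgeCM.HermSpace3.Hm V, HodgeCM.HermSpace3.isHermitian V, HodgeCM.HermSpace3.signature_ι₁ V, HodgeCM.HermSpace3.posDef_of_ne V⟩ Φ h6).restOne (AlgHom.id ℚ _) ι₁ hν hw (Def45.Carriers.ofPolDR ν (Def45.PolDR ι₁ hν (Def45.RMuForm ι₁ hν)))
          (uniformOmegaRep h ⟨HodgeCM.CMField.K F⟩ ι₁ ⟨HodgeCM.HermSpace3.Hm V, HodgeCM.HermSpace3.isHermitian V, HodgeCM.HermSpace3.signature_ι₁ V, HodgeCM.HermSpace3.posDef_of_ne V⟩ Φ e₁ (frameD V) (frameD_real V) (frameD_ne V) (ιVE V) (2 * imagUnit (HodgeCM.CMField.K F))⁻¹ (fun _ _ => (Rep.update ↥(maximalRealSubfield (HodgeCM.CMField.K F)) (imagUnitSq (HodgeCM.CMField.K F)) (Rep.ofLineOf ↥(maximalRealSubfield (HodgeCM.CMField.K F)) (imagUnitSq (HodgeCM.CMField.K F))) (locF ↥(maximalRealSubfield (HodgeCM.CMField.K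 F)) (imagUnitSq (HodgeCM.CMField.K F)) (realUnit ⟨HodgeCM.CMField.K F⟩ a.1 a.2.1 a.2.2)) (realUnit ⟨HodgeCM.CMField.K F⟩ a.1 a.2.1 a.2.2) rfl))).Eps
          (fun e => (uniformOmegaRep h ⟨HodgeCM.CMField.K F⟩ ι₁ ⟨HodgeCM.HermSpace3.Hm V, HodgeCM.HermSpace3.isHermitian V, HodgeCM.HermSpace3.signature_ι₁ V, HodgeCM.HermSpace3.posDef_of_ne V⟩ Φ e₁ (frameD V) (frameD_real V) (frameD_ne V) (ιVE V) (2 * imagUnit (HodgeCM.CMField.K F))⁻¹ (fun _ _ => (Rep.update ↥(maximalRealSubfield (HodgeCM.CMField.K F)) (imagUnitSq (HodgeCM.CMField.K F)) (Rep.ofLineOf ↥(maximalRealSubfield (HodgeCM.CMField.K F)) (imagUnitSq (HodgeCM.CMField.K F))) (locF ↥(maximalRealSubfield (HodgeCM.CMField.K F)) (imagUnitSq (HodgeCM.CMField.K F)) (realUnit ⟨HodgeCM.CMField.K F⟩ a.1 a.2.1 a.2.2)) (realUnit ⟨HodgeCM.CMField.K F⟩ a.1 a.2.1 a.2.2) rfl))).epsOf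 (-e))
          (uniformOmegaRep h ⟨HodgeCM.CMField.K F⟩ ι₁ ⟨HodgeCM.HermSpace3.Hm V, HodgeCM.HermSpace3.isHermitian V, HodgeCM.HermSpace3.signature_ι₁ V, HodgeCM.HermSpace3.posDef_of_ne V⟩ Φ e₁ (frameD V) (frameD_real V) (frameD_ne V) (ιVE V) (2 * imagUnit (HodgeCM.CMField.K F))⁻¹ (fun _ _ => (Rep.update ↥(maximalRealSubfield (HodgeCM.CMField.K F)) (imagUnitSq (HodgeCM.CMField.K F)) (Rep.ofLineOf ↥(maximalRealSubfield (HodgeCM.CMField.K F)) (imagUnitSq (HodgeCM.CMField.K F))) (locF ↥(maximalRealSubfield (HodgeCM.CMField.K F)) (imagUnitSq (HodgeCM.CMField.K F)) (realUnit ⟨HodgeCM.CMField.K F⟩ a.1 a.2.1 a.2.2)) (realUnit ⟨HodgeCM.CMField.K F⟩ a.1 a.2.1 a.2.2) rfl))).Chi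
          ((uniformOmegaRep h ⟨HodgeCM.CMField.K F⟩ ι₁ ⟨HodgeCM.HermSpace3.Hm V, HodgeCM.HermSpace3.isHermitian V, HodgeCM.HermSpace3.signature_ι₁ V, HodgeCM.HermSpace3.posDef_of_ne V⟩ Φ e₁ (frameD V) (frameD_real V) (frameD_ne V) (ιVE V) (2 * imagUnit (HodgeCM.CMField.K F))⁻¹ (fun _ _ => (Rep.update ↥(maximalRealSubfield (HodgeCM.CMField.K F)) (imagUnitSq (HodgeCM.CMField.K F)) (Rep.ofLineOf ↥(maximalRealSubfield (HodgeCM.CMField.K F)) (imagUnitSq (HodgeCM.CMField.K F))) (locF ↥(maximalRealSubfield (HodgeCM.CMField.K F)) (imagUnitSq (HodgeCM.CMField.K F)) (realUnit ⟨HodgeCM.CMField.K F⟩ a.1 a.2.1 a.2.2)) (realUnit ⟨HodgeCM.CMField.K F⟩ a.1 a.2.1 a.2.2) rfl))).omega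
          (galConj (IsCMField.complexConj _) ν) hν.galConj)
          ((uniformOmegaRep h ⟨HodgeCM.CMField.K F⟩ ι₁ ⟨HodgeCM.HermSpace3.Hm V, HodgeCM.HermSpace3.isHermitian V, HodgeCM.HermSpace3.signature_ι₁ V, HodgeCM.HermSpace3.posDef_of_ne V⟩ Φ e₁ (frameD V) (frameD_real V) (frameD_ne V) (ιVE V) (2 * imagUnit (HodgeCM.CMField.K F))⁻¹ (fun _ _ => (Rep.update ↥(maximalRealSubfield (HodgeCM.CMField.K F)) (imagUnitSq (HodgeCM.CMField.K F)) (Rep.ofLineOf ↥(maximalRealSubfield (HodgeCM.CMField.K F)) (imagUnitSq (HodgeCM.CMField.K F))) (locF ↥(maximalRealSubfield (HodgeCM.CMField.K F)) (imagUnitSq (HodgeCM.CMField.K F)) (realUnit ⟨HodgeCM.CMField.K F⟩ a.1 a.2.1 a.2.2)) (realUnit ⟨HodgeCM.CMField.K F⟩ a.1 a.2.1 a.2.2) rfl))).rho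
          (galConj (IsCMField.complexConj _) ν) hν.galConj))) :=
    fun F hG h6 {ι₁} V a Φ hΦ ν hν hw => by
        haveI : IsGalois ℚ F := hG
        -- the identification binder DISCHARGED IN KERNEL: RSCONJ row R6 over `Model.RecordSystemConj.exists_conj` (module `HComp.RecordSystemConj`)
        obtain ⟨R', hR'⟩ :=
          Summit.HodgeConjecture.CorCM.D2Bridge.MuConjIdent.exists_recordSystemConj_X_sec42DataOf_levelOf_eq
            (Summit.HodgeConjecture.CorCM.DelRec.exists_recordSystem_of_printed hDel)
            (⟨HodgeCM.HermSpace3.Hm V, HodgeCM.HermSpace3.isHermitian V, HodgeCM.HermSpace3.signature_ι₁ V, HodgeCM.HermSpace3.posDef_of_ne V⟩ : Summit.HodgeConjecture.CorCM.HermSpace3 ⟨HodgeCM.CMField.K F⟩ ι₁) Φ isoOf h6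
        -- T CONSUMED IN KERNEL: [Thm. 4.18] at the conjugate space's transported datum is TRANSPORTED BACK to the printed datum `D_print(a, ν)` by ✔ Ω-VII
        -- `MuConjIdent.thm418AsPrinted_muConj_rest_of_transport_hermConj` (which consumes ✔ Ω-M internally); `Φ′ := Φ`; the tail `t` is read off the
        -- displayed row; `c(δ′) = −δ′`, `δ′ ≠ 0` for `δ′ = (2δ_F)⁻¹` are ✔ `OmegaTransport.complexConj_inv_two_mul_imagUnit ∕ inv_two_mul_imagUnit_ne_zero`;
        -- the slot elaborates because `(muConj 𝕌).rest t` IS `D_print(a, ν)` definitionally (✔ `MuConjIdent.toThm418Data_muConj_rest_eq_printed_ofRecord`, `rfl`) — T-4.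
        exact Summit.HodgeConjecture.CorCM.D2Bridge.MuConjIdent.thm418AsPrinted_muConj_rest_of_transport_hermConj ⟨HodgeCM.CMField.K F⟩ (Summit.HodgeConjecture.CorCM.DelRec.exists_recordSystem_of_printed hDel) ι₁
          (⟨HodgeCM.HermSpace3.Hm V, HodgeCM.HermSpace3.isHermitian V, HodgeCM.HermSpace3.signature_ι₁ V, HodgeCM.HermSpace3.posDef_of_ne V⟩ : Summit.HodgeConjecture.CorCM.HermSpace3 ⟨HodgeCM.CMField.K F⟩ ι₁) Φ Φ e₁ (frameD V) (ιVE V) (2 * imagUnit (HodgeCM.CMField.K F))⁻¹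
          (fun _ _ => (Rep.update ↥(maximalRealSubfield (HodgeCM.CMField.K F)) (imagUnitSq (HodgeCM.CMField.K F)) (Rep.ofLineOf ↥(maximalRealSubfield (HodgeCM.CMField.K F)) (imagUnitSq (HodgeCM.CMField.K F))) (locF ↥(maximalRealSubfield (HodgeCM.CMField.K F)) (imagUnitSq (HodgeCM.CMField.K F)) (realUnit ⟨HodgeCM.CMField.K F⟩ a.1 a.2.1 a.2.2)) (realUnit ⟨HodgeCM.CMField.K F⟩ a.1 a.2.1 a.2.2) rfl))
          (frameD_real V) (frameD_ne V) (diagonal_frameD_map_complexConj F V)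
          (Summit.HodgeConjecture.CorCM.Transposition.OmegaTransport.complexConj_inv_two_mul_imagUnit ⟨HodgeCM.CMField.K F⟩)
          (Summit.HodgeConjecture.CorCM.Transposition.OmegaTransport.inv_two_mul_imagUnit_ne_zero ⟨HodgeCM.CMField.K F⟩) ν hν _
          (hLiu418 F h6 V a Φ hΦ ν hν hw R' hR' Φ)
  -- (ident) the printed datum IS `(muConj 𝕌).rest 𝔱⟦ν⟧` (`rfl`-transport of ✔ `MuKeyIdentEnd`), pointwise
  have hLiuC : ∀ (F : HodgeCM.CMField) [IsGalois ℚ F] (h6 : 6 ≤ Module.finrank ℚ F) {ι₁ : F →+* ℂ} (V : HodgeCM.HermSpace3 F ι₁) (a : RealScalar F)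
        (Φ : CMType F) (hΦ : ι₁ ∈ Φ.1) (ν : Literature.NumberTheory.Automorphic.IdeleClassGroup (F : Type) →ₜ* Circle)
        (hν : IdeleClassGroup.IsConjugateSymplectic (F : Type) ν) (hw : IdeleClassGroup.HasWeight (F : Type) ν 1),
        Thm418AsPrinted (toThm418Data _ ((Summit.HodgeConjecture.CorCM.D2Bridge.AdapterMuConj.muConj (uniformOmegaRep h ⟨HodgeCM.CMField.K F⟩ ι₁ ⟨HodgeCM.HermSpace3.Hm V, HodgeCM.HermSpace3.isHermitian V, HodgeCM.HermSpace3.signature_ι₁ V, HodgeCM.HermSpace3.posDef_of_ne V⟩ Φ e₁ (frameD V) (frameD_real V) (frameD_ne V) (ιVE V) (2 * imagUnit (HodgeCM.CMField.K F))⁻¹ (fun _ _ => (Rep.update ↥(maximalRealSubfield (HodgeCM.CMField.K F)) (imagUnitSq (HodgeCM.CMField.K F)) (Rep.ofLineOf ↥(maximalRealSubfield (HodgeCM.CMField.K F)) (imagUnitSq (HodgeCM.CMField.K F))) (locF ↥(maximalRealSubfield (HodgeCM.CMField.K F)) (imagUnitSq (HodgeCM.CMField.K F)) (realUnit ⟨HodgeCM.CMField.K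 F⟩ a.1 a.2.1 a.2.2)) (realUnit ⟨HodgeCM.CMField.K F⟩ a.1 a.2.1 a.2.2) rfl)))).rest (restTailOne (AlgHom.id ℚ _) ι₁ hν hw (Def45.Carriers.ofPolDR ν (Def45.PolDR ι₁ hν (Def45.RMuForm ι₁ hν))) ((heckeTranslatesFamilyOf heckeTranslate_definedOver_holds h isoOf ⟨HodgeCM.CMField.K F⟩ ι₁ ⟨HodgeCM.HermSpace3.Hm V, HodgeCM.HermSpace3.isHermitian V, HodgeCM.HermSpace3.signature_ι₁ V, HodgeCM.HermSpace3.posDef_of_ne V⟩ Φ h6).rhoΩOne (AlgHom.id ℚ _) ι₁ hν hw (Def45.Carriers.ofPolDR ν (Def45.PolDR ι₁ hν (Def45.RMuForm ι₁ hν))))))) :=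
    fun F hG h6 {ι₁} V a Φ hΦ ν hν hw => by
      haveI : IsGalois ℚ F := hG
      exact (Summit.HodgeConjecture.CorCM.D2Bridge.MuConjIdent.toThm418Data_muConj_rest_eq_printed_ofRecord F h6 V a h Φ ν hν hw) ▸ hLiu418' F h6 V a Φ hΦ ν hν hw
  -- (μ-key END, W2) with `h413` and `hD3` consumed AT PLACE only (inside the `h418` reading under `hV`)
  exact
    hc_cm_of_homNeZero_along_conj_holds_restOne_epi_meeting_rec h (Summit.HodgeConjecture.CorCM.D2Bridge.MuKeyEnd.hHom_of_scalar_rows h hLiuC h411 hD1'') h21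
      (hM_of_port_local (fun F hG h6 {ι₁} V hV a₀ => by
        haveI : IsGalois ℚ F := hG
        -- a CM type of `F` containing `ι₁` ([Liu21] Def. 4.3 `Φ_e` at the constant ∞-type `e = −1`; `ι₁` canonical by `hV`)
        let Φ : CMType F := Literature.NumberTheory.Automorphic.IdeleClassGroup.cmTypeOf (F : Type) (fun _ => (-1 : ℤ)) (fun _ => by decide)
        have hΦ : ι₁ ∈ Φ.1 := hV ▸ Literature.NumberTheory.Automorphic.IdeleClassGroup.embedding_mem_cmTypeOf_iff.2 (by decide)
        exact thm418C_indexOfRecord_of_muConj F h6 V hV a₀ h Φ h21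
          (fun i ν hν hw => hLiuC F h6 V (repAt a₀ (Sigma.fst i)) Φ hΦ ν hν hw)
          (fun i μ hμ hw => h411 F h6 V (repAt a₀ (Sigma.fst i)) Φ hΦ μ hμ hw)
          (h413 F h6 V hV a₀ Φ hΦ)
          (fun i s t hs hst => mu_eq_of_areIsomorphic_uniformOmegaRep_of_lemD1_3AsPrintedI h ⟨HodgeCM.CMField.K F⟩ h6 ι₁ ⟨HodgeCM.HermSpace3.Hm V, HodgeCM.HermSpace3.isHermitian V, HodgeCM.HermSpace3.signature_ι₁ V, HodgeCM.HermSpace3.posDef_of_ne V⟩ Φ e₁ (frameD V) (frameD_real V) (frameD_ne V) (ιVE V)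
            (Rep.update ↥(maximalRealSubfield (HodgeCM.CMField.K F)) (imagUnitSq (HodgeCM.CMField.K F)) (Rep.ofLineOf ↥(maximalRealSubfield (HodgeCM.CMField.K F)) (imagUnitSq (HodgeCM.CMField.K F))) (locF ↥(maximalRealSubfield (HodgeCM.CMField.K F)) (imagUnitSq (HodgeCM.CMField.K F)) (realUnit ⟨HodgeCM.CMField.K F⟩ (repAt a₀ (Sigma.fst i)).1 (repAt a₀ (Sigma.fst i)).2.1 (repAt a₀ (Sigma.fst i)).2.2)) (realUnit ⟨HodgeCM.CMField.K F⟩ (repAt a₀ (Sigma.fst i)).1 (repAt a₀ (Sigma.fst i)).2.1 (repAt a₀ (Sigma.fst i)).2.2) rfl) (le_refl 3)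
            ((liuDictionaryPin exists_isReal_hodgeModel_holds hodgePQ_independent_of_hodgeModel_holds BallQuotient.ballQuotientUniformised_holds (cmAbelianVarietyRealised_of_eigenbasis exists_isReal_hodgeModel_holds hodgePQ_independent_of_hodgeModel_holds cmAbelianVarietyEigenbasisRealised_holds) Literature.NumberTheory.Transcendental.arapura2012_cor_15_4_6_holds V (I V (repAt a₀) (muLiu ι₁ GramClass.rep)) (line V (repAt a₀) (muLiu ι₁ GramClass.rep)))).H
            (UnitaryDualPair.finPart_cmKTypeHom_finAdelicToAdelic_surjective (F : Type) V.Hm (frameG V) (frameD V) (frame_congr V))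
            (fun μ hμ hw j v => hD1'' F h6 V (repAt a₀ (Sigma.fst i)) Φ hΦ μ hμ hw j v) (hD3 F h6 V hV (repAt a₀ (Sigma.fst i)) Φ hΦ) s t hs hst)
          (fun i μ hμ hw _ j v => hD1'' F h6 V (repAt a₀ (Sigma.fst i)) Φ hΦ μ hμ hw j v)))


end Summit.HodgeConjecture.CorCM.D2Bridge.AtPlaceEndT
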